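import Summits.QuantumFields.BalabanUV.Beta.WilsonStencilReflection
import Summits.QuantumFields.BalabanUV.Beta.WilsonStencilTransport
import Summits.QuantumFields.BalabanUV.Beta.DiagonalContact
import Summits.QuantumFields.BalabanUV.Beta.BorderedHessianSymmetry
import Literature.MathematicalPhysics.QuantumFieldTheory.Balaban1983to89.Beta.StepJetData
import Literature.MathematicalPhysics.QuantumFieldTheory.Balaban1983to89.Beta.ResolventReflection

/-!
# The reflection law WITH CONTACT of an2's antisymmetric Wilson table `wilsonA` on `ℤ^(d+1)`

HONEST FRAMING.  Discharging `BetaPertH` makes Balaban's ultraviolet stability UNCONDITIONAL — a real constructive-QFT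
result; it is NOT the continuum limit and NOT the Clay problem.  This leaf is bookkeeping for ONE entry of an2's assembly of
the reflected one-step jet (cell pub-balaban, β sub-cell, lane an3; demand X-an2-45 §3 (ii) ∕ (R45-4), BINDER-OWNERS row D1 (iii)):
finite algebra, no estimate, no limit, nothing cited — every statement is kernel-proved ([folklore] = standard finite algebra).

THE STATEMENT (`wilsonA_bref`).  For every axis `α`, jet bond direction `κ′` and base site `u` of `ℤ^(d+1)`:

  `wilsonA d κ′ (bref α κ′ u) = reflSign α κ′ • refK (Φ N α) (wilsonA d κ′ u + (−½) • wilsonCt d α κ′ u)`,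

where `ResolventReflection.bref ∕ Φ`, `PolarizationSign.reflSign`, `KernelReflection.refK` are an2's reflection data, and the
CONTACT TABLE `wilsonCt d α κ′ u` (field–field block only) is LITERALLY the right-hand side of an2's
`DiagonalContact.conjV_bhKAt_ctGen_inl_inl` with the window-free `d*d` entry (`BorderedHessianKernelAction.bhK_inl_inl_eq`):
`wilsonCt x z (inl a) (inl b) = [κ′ = α] · (d*d δ_{(b,z)})_a(x) · ([x = u ∧ a = κ′] − [z = u ∧ b = κ′])`, zero on the other blocks;
`wilsonCt_inl_inl_eq_conjV` records `wilsonCt x z (inl a) (inl b) = conjV (bhKAt d (ctr (d+1) L) L) (diagK (ctGen d α L κ′ u)) x z (inl a) (inl b)`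
for every `L`.  So the Wilson piece obeys an2's (Sr-conj) shape with the product-chart generator `ctGen` and the explicit
coefficient `c_W = −½` on the field–field block (Lean decides the constant: it is `−½`, as the hand computation predicted).

THE PROOF.  (1) `wilsonA`'s field block is the antisymmetrised colourless stencil `WilsonReflectionFrame.S₀A` read with the frame
`B6BondElimination.unitVec` (`wilsonA_inl_inl`).  (2) The finite-lattice law `WilsonStencilReflection.S₀A_reflect` is instantiated
on the torus `(ZMod M)^(d+1)` with the reflection `srefM` (`x_α ↦ −1 − x_α`), which obeys the frame laws, and pulled back to
`ℤ^(d+1)` along `WilsonStencilTransport.castVec M`, injective on the finite window of sites that occur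
(`WilsonStencilTransport.castVec_injOn`, naturality `wα_map ∕ wβ_map`): `S₀A_bref`.  (3) The contact functional is half the
`d*d` matrix entry: `curvAdj (curv (delta1 a X)) α u = 2 · Lc unitVec α u (X, a)` (`curvAdj_curv_delta1_eq_two_mul_Lc`, from the
antisymmetry of the lattice curl), and the symmetry `BorderedHessianSymmetry.curvAdj_curv_delta1_symm` brings both contact terms to
an2's common factor.
-/

namespace Summit.QuantumFields.BalabanUV.Beta.WilsonReflectionContact

open Finset
open scoped BigOperators
open Literature.MathematicalPhysics.QuantumFieldTheory.Balaban1983to89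
open Literature.MathematicalPhysics.QuantumFieldTheory.Balaban1983to89.Beta
open PlaquetteVertex (lcurl bondLetter)
open PlaquetteStencilData (WilsonIdx wα wβ)
open WilsonVertexKron (wilsonStencil₀ wilsonStencil₀_apply_eq_unit)
open StepJetData (wEntry wilsonA)
open ResolventReflection (sref sref_apply bref bref_apply bref_bref Φ Φ_r_inl Φ_s_inl)
open PolarizationSign (reflSign)
open KernelReflection (refK refK_apply)
open ExpKernelCalculus (MKer)
open OneStepResolventKernel (Fib)
open AffineAveraging (curv curvAdj)
open KKTFluctuationKernel (delta1 delta1_apply)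
open B6BondElimination (unitVec unitVec_apply)
open AveragingContoursRooted (ctr)
open Summit.QuantumFields.BalabanUV.Beta.ChartConjugation (conjV)
open Summit.QuantumFields.BalabanUV.Beta.BorderedHessian (diagK ctGen bhKAt bhK conjV_bhKAt_ctGen_inl_inl bhK_inl_inl_eq
  curvAdj_curv_delta1_symm)
open Summit.QuantumFields.BalabanUV.Beta.WilsonReflectionFrame (sgn rsite rpt Lc S₀A)
open Summit.QuantumFields.BalabanUV.Beta.WilsonStencilReflection (S₀A_reflect)
open Summit.QuantumFields.BalabanUV.Beta.WilsonStencilTransport (castVec castVec_apply castVec_injOn S₀A_map Lc_map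
  prod_eq_iff_of_injOn)

variable {d : ℕ}

/-! ## §1 The torus reflection and the reduction of an2's reflection data -/

section Torus

variable {n : ℕ}

/-- THE REFLECTION `x_α ↦ −1 − x_α` ON THE DISCRETE TORUS `(ZMod M)^n`.  A definition asserting nothing. [folklore] -/
def srefM (M : ℕ) (α : Fin n) (y : Fin n → ZMod M) : Fin n → ZMod M := fun i => if i = α then -1 - y i else y i

/-- `srefM` is an involution. [folklore] -/
theorem srefM_involutive (M : ℕ) (α : Fin n) : Function.Involutive (srefM M α) := by
  intro y; funext i; unfold srefM
  by_cases hi : i = α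
  · rw [if_pos hi, if_pos hi]; ring
  · rw [if_neg hi, if_neg hi]

/-- first frame law: `srefM` commutes with the frame translations off the axis. [folklore] -/
theorem srefM_frame₁ (M : ℕ) {α κ : Fin n} (hκ : κ ≠ α) (y : Fin n → ZMod M) :
    srefM M α (y + castVec M (unitVec κ)) = srefM M α y + castVec M (unitVec κ) := by
  funext i
  simp only [srefM, Pi.add_apply, castVec_apply, unitVec_apply, Int.cast_ite, Int.cast_one, Int.cast_zero]
  by_cases hi : i = α
  · subst hi; rw [if_pos rfl, if_pos rfl, if_neg (Ne.symm hκ)]; ring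
  · rw [if_neg hi, if_neg hi]

/-- second frame law: `srefM` reverses the frame translation along the axis. [folklore] -/
theorem srefM_frame₂ (M : ℕ) (α : Fin n) (y : Fin n → ZMod M) :
    srefM M α (y + castVec M (unitVec α)) = srefM M α y - castVec M (unitVec α) := by
  funext i
  simp only [srefM, Pi.add_apply, Pi.sub_apply, castVec_apply, unitVec_apply, Int.cast_ite, Int.cast_one, Int.cast_zero]
  by_cases hi : i = α
  · rw [if_pos hi, if_pos hi, if_pos hi]; ring
  · rw [if_neg hi, if_neg hi, if_neg hi]; ring

/-- the two unit-vector conventions of the tree agree: `AffineAveraging.unitVec = B6BondElimination.unitVec`. [folklore] -/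
theorem unitVec_eq (κ : Fin n) : AffineAveraging.unitVec κ = unitVec κ := by
  funext i; rw [AffineAveraging.unitVec_apply, unitVec_apply]

/-- reduction of the axis reflection: `castVec M ∘ sref α = srefM M α ∘ castVec M`. [folklore] -/
theorem castVec_sref (M : ℕ) (α : Fin n) (x : Fin n → ℤ) : castVec M (sref α x) = srefM M α (castVec M x) := by
  funext i
  simp only [castVec_apply, sref_apply, srefM, Int.cast_ite, Int.cast_sub, Int.cast_neg, Int.cast_one]

/-- reduction of the bond base-point map: `castVec M (bref α κ x) = rsite (srefM M α) (castVec M ∘ unitVec) α κ (castVec M x)`.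
[folklore] -/
theorem castVec_bref (M : ℕ) (α κ : Fin n) (x : Fin n → ℤ) :
    castVec M (bref α κ x) = rsite (srefM M α) (⇑(castVec M) ∘ unitVec) α κ (castVec M x) := by
  unfold bref rsite
  rw [map_sub, castVec_sref]
  by_cases hκ : κ = α
  · rw [if_pos hκ, if_pos hκ, Function.comp_apply, unitVec_eq]
  · rw [if_neg hκ, if_neg hκ, map_zero]

/-- the signs agree: `WilsonReflectionFrame.sgn = PolarizationSign.reflSign`. [folklore] -/
theorem sgn_eq_reflSign (α κ : Fin n) : sgn α κ = reflSign α κ := rfl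

/-- THE TORUS LAW: `WilsonStencilReflection.S₀A_reflect` on `(ZMod M)^(d+1)` with the reflection `srefM M α` and the reduced
frame `castVec M ∘ unitVec`. [folklore] -/
theorem torus_law (M : ℕ) [NeZero M] (α κ' : Fin (d + 1)) (u : Fin (d + 1) → ZMod M)
    (p q : (Fin (d + 1) → ZMod M) × Fin (d + 1)) :
    S₀A (⇑(castVec M) ∘ unitVec) (rsite (srefM M α) (⇑(castVec M) ∘ unitVec) α κ' u) κ'
        (rpt (srefM M α) (⇑(castVec M) ∘ unitVec) α p) (rpt (srefM M α) (⇑(castVec M) ∘ unitVec) α q) =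
      sgn α κ' * sgn α p.2 * sgn α q.2 * (S₀A (⇑(castVec M) ∘ unitVec) u κ' p q + (if α = κ' then
        Lc (⇑(castVec M) ∘ unitVec) α u p * (if (u, α) = q then 1 else 0) -
          Lc (⇑(castVec M) ∘ unitVec) α u q * (if (u, α) = p then 1 else 0) else 0)) :=
  S₀A_reflect (srefM_involutive M α) (fun y _ hκ => srefM_frame₁ M hκ y) (srefM_frame₂ M α) u κ' p q

end Torus

/-! ## §2 The finite window of sites and the transfer to `ℤ^(d+1)` -/

section Transfer

/-- index type of the finite family of sites entering the transfer.  A definition asserting nothing. [folklore] -/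
abbrev WIdx (d : ℕ) : Type :=
  (((Bool × Bool) ⊕ Unit) ⊕ ((Bool × Bool) × WilsonIdx (Fin (d + 1)))) ⊕ ((Fin (d + 1) × Fin (d + 1)) ⊕ (Bool × Fin (d + 1)))

/-- THE FINITE FAMILY OF SITES entering the transfer of the law for the legs `(x,a), (z,b)` and the jet bond `(u,κ′)`: the legs,
their reflections, `u`, the stencil supports around `bref α κ′ u` and around `u`, and the sites `u − e_ν + e_μ`, `u − e_ν`, `u + e_μ`
read by the contact functional.  A definition asserting nothing. [folklore] -/
def wpts (α κ' a b : Fin (d + 1)) (u x z : Fin (d + 1) → ℤ) : WIdx d → (Fin (d + 1) → ℤ)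
  | Sum.inl (Sum.inl (Sum.inl (true, true))) => x
  | Sum.inl (Sum.inl (Sum.inl (true, false))) => z
  | Sum.inl (Sum.inl (Sum.inl (false, true))) => bref α a x
  | Sum.inl (Sum.inl (Sum.inl (false, false))) => bref α b z
  | Sum.inl (Sum.inl (Sum.inr _)) => u
  | Sum.inl (Sum.inr ((true, true), i)) => bref α κ' u + wα unitVec κ' i
  | Sum.inl (Sum.inr ((true, false), i)) => bref α κ' u + wβ unitVec κ' i
  | Sum.inl (Sum.inr ((false, true), i)) => u + wα unitVec κ' i
  | Sum.inl (Sum.inr ((false, false), i)) => u + wβ unitVec κ' i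
  | Sum.inr (Sum.inl νμ) => u - unitVec νμ.1 + unitVec νμ.2
  | Sum.inr (Sum.inr (true, ν)) => u - unitVec ν
  | Sum.inr (Sum.inr (false, μ)) => u + unitVec μ

/-- THE MODULUS of the transfer torus: one more than the sum of all coordinate differences of the family.  A definition asserting
nothing. [folklore] -/
def wmod (α κ' a b : Fin (d + 1)) (u x z : Fin (d + 1) → ℤ) : ℕ :=
  ∑ i, ∑ i', ∑ j, (wpts α κ' a b u x z i j - wpts α κ' a b u x z i' j).natAbs

/-- **THE REFLECTION LAW WITH CONTACT OF THE ANTISYMMETRISED COLOURLESS WILSON STENCIL ON `ℤ^(d+1)`** (frame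
`B6BondElimination.unitVec`, reflection data `ResolventReflection.bref`, signs `PolarizationSign.reflSign`):
`S₀A(bref α κ′ u, κ′; (x,a), (z,b)) = ε_κ′ ε_a ε_b · (S₀A(u, κ′; (bref α a x, a), (bref α b z, b)) + [κ′ = α]·(Lc(X,a)·[(u,α) = (Z,b)] − Lc(Z,b)·[(u,α) = (X,a)]))`
with `X = bref α a x`, `Z = bref α b z` — the torus law pulled back along `castVec (wmod + 1)`. [folklore] -/
theorem S₀A_bref (α κ' a b : Fin (d + 1)) (u x z : Fin (d + 1) → ℤ) :
    S₀A unitVec (bref α κ' u) κ' (x, a) (z, b) =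
      reflSign α κ' * reflSign α a * reflSign α b *
        (S₀A unitVec u κ' (bref α a x, a) (bref α b z, b) + (if α = κ' then
          Lc unitVec α u (bref α a x, a) * (if (u, α) = (bref α b z, b) then 1 else 0) -
            Lc unitVec α u (bref α b z, b) * (if (u, α) = (bref α a x, a) then 1 else 0) else 0)) := by
  have hS : Set.InjOn (castVec (wmod α κ' a b u x z + 1)) (Set.range (wpts α κ' a b u x z)) :=
    castVec_injOn (wpts α κ' a b u x z)
  have key := torus_law (wmod α κ' a b u x z + 1) α κ' (castVec _ u) (castVec _ (bref α a x), a) (castVec _ (bref α b z), b)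
  have r₁ : rsite (srefM (wmod α κ' a b u x z + 1) α) (⇑(castVec (wmod α κ' a b u x z + 1)) ∘ unitVec) α κ' (castVec _ u) =
      castVec _ (bref α κ' u) := (castVec_bref _ α κ' u).symm
  have r₂ : rpt (srefM (wmod α κ' a b u x z + 1) α) (⇑(castVec (wmod α κ' a b u x z + 1)) ∘ unitVec) α
      (castVec _ (bref α a x), a) = (castVec _ x, a) := by
    show (rsite _ _ α a (castVec _ (bref α a x)), a) = _
    rw [← castVec_bref, bref_bref]
  have r₃ : rpt (srefM (wmod α κ' a b u x z + 1) α) (⇑(castVec (wmod α κ' a b u x z + 1)) ∘ unitVec) α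
      (castVec _ (bref α b z), b) = (castVec _ z, b) := by
    show (rsite _ _ α b (castVec _ (bref α b z)), b) = _
    rw [← castVec_bref, bref_bref]
  rw [r₁, r₂, r₃] at key
  dsimp only at key
  have mx : x ∈ Set.range (wpts α κ' a b u x z) := ⟨Sum.inl (Sum.inl (Sum.inl (true, true))), rfl⟩
  have mz : z ∈ Set.range (wpts α κ' a b u x z) := ⟨Sum.inl (Sum.inl (Sum.inl (true, false))), rfl⟩
  have mX : bref α a x ∈ Set.range (wpts α κ' a b u x z) := ⟨Sum.inl (Sum.inl (Sum.inl (false, true))), rfl⟩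
  have mZ : bref α b z ∈ Set.range (wpts α κ' a b u x z) := ⟨Sum.inl (Sum.inl (Sum.inl (false, false))), rfl⟩
  have mu : u ∈ Set.range (wpts α κ' a b u x z) := ⟨Sum.inl (Sum.inl (Sum.inr ())), rfl⟩
  have mα₁ : ∀ i, bref α κ' u + wα unitVec κ' i ∈ Set.range (wpts α κ' a b u x z) :=
    fun i => ⟨Sum.inl (Sum.inr ((true, true), i)), rfl⟩
  have mβ₁ : ∀ i, bref α κ' u + wβ unitVec κ' i ∈ Set.range (wpts α κ' a b u x z) :=
    fun i => ⟨Sum.inl (Sum.inr ((true, false), i)), rfl⟩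
  have mα₂ : ∀ i, u + wα unitVec κ' i ∈ Set.range (wpts α κ' a b u x z) := fun i => ⟨Sum.inl (Sum.inr ((false, true), i)), rfl⟩
  have mβ₂ : ∀ i, u + wβ unitVec κ' i ∈ Set.range (wpts α κ' a b u x z) := fun i => ⟨Sum.inl (Sum.inr ((false, false), i)), rfl⟩
  have m₃ : ∀ ν μ, u - unitVec ν + unitVec μ ∈ Set.range (wpts α κ' a b u x z) := fun ν μ => ⟨Sum.inr (Sum.inl (ν, μ)), rfl⟩
  have m₁ : ∀ ν, u - unitVec ν ∈ Set.range (wpts α κ' a b u x z) := fun ν => ⟨Sum.inr (Sum.inr (true, ν)), rfl⟩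
  have m₂ : ∀ μ, u + unitVec μ ∈ Set.range (wpts α κ' a b u x z) := fun μ => ⟨Sum.inr (Sum.inr (false, μ)), rfl⟩
  rw [S₀A_map _ hS unitVec (bref α κ' u) κ' mx mz mα₁ mβ₁, S₀A_map _ hS unitVec u κ' mX mZ mα₂ mβ₂,
    Lc_map _ hS unitVec α u (bref α a x) a mX mu m₁ m₂ m₃, Lc_map _ hS unitVec α u (bref α b z) b mZ mu m₁ m₂ m₃] at key
  simp only [prod_eq_iff_of_injOn _ hS mu mZ, prod_eq_iff_of_injOn _ hS mu mX] at key
  simpa only [sgn_eq_reflSign] using key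

end Transfer

/-! ## §3 an2's table `wilsonA` is the antisymmetrised colourless stencil; the contact functional is half the `d*d` entry -/

section Tables

/-- `wilsonA`'s field–field block is `S₀A` read with the frame `unitVec`. [folklore] -/
theorem wilsonA_inl_inl (κ' : Fin (d + 1)) (u x z : Fin (d + 1) → ℤ) (a b : Fin (d + 1)) :
    wilsonA d κ' u x z (Sum.inl a) (Sum.inl b) = S₀A unitVec u κ' (x, a) (z, b) := by
  show (1 / 2 : ℝ) * (wEntry d κ' u x z a b - wEntry d κ' u z x b a) = _
  unfold wEntry S₀A
  rw [wilsonStencil₀_apply_eq_unit, wilsonStencil₀_apply_eq_unit]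

/-- `wilsonA` vanishes on the field–multiplier block. [folklore] -/
theorem wilsonA_inl_inr (κ' : Fin (d + 1)) (u x z : Fin (d + 1) → ℤ) (a b : Fin (d + 1)) :
    wilsonA d κ' u x z (Sum.inl a) (Sum.inr b) = 0 := rfl

/-- `wilsonA` vanishes on the multiplier–field block. [folklore] -/
theorem wilsonA_inr_inl (κ' : Fin (d + 1)) (u x z : Fin (d + 1) → ℤ) (a b : Fin (d + 1)) :
    wilsonA d κ' u x z (Sum.inr a) (Sum.inl b) = 0 := rfl

/-- `wilsonA` vanishes on the multiplier–multiplier block. [folklore] -/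
theorem wilsonA_inr_inr (κ' : Fin (d + 1)) (u x z : Fin (d + 1) → ℤ) (a b : Fin (d + 1)) :
    wilsonA d κ' u x z (Sum.inr a) (Sum.inr b) = 0 := rfl

/-- the lattice curvature of `AffineAveraging` is the lattice curl of `PlaquetteVertex` (transposed indexing). [folklore] -/
theorem curv_eq_lcurl (A : AffineAveraging.Form1 (d + 1) ℝ) (κ l : Fin (d + 1)) (y : Fin (d + 1) → ℤ) :
    curv A κ l y = lcurl AffineAveraging.unitVec (fun w μ => A μ w) y κ l := by
  unfold curv lcurl; ring

/-- **`d*d` THROUGH THE CURL**: `curvAdj (curv A) μ y = 2 · Σ_ν (lcurl A (y − e_ν) ν μ − lcurl A y ν μ)` (antisymmetry of the curl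
folds the two sums of `curvAdj` into one). [folklore] -/
theorem curvAdj_curv_eq_two_mul (A : AffineAveraging.Form1 (d + 1) ℝ) (μ : Fin (d + 1)) (y : Fin (d + 1) → ℤ) :
    curvAdj (curv A) μ y = 2 * ∑ ν, (lcurl AffineAveraging.unitVec (fun w κ => A κ w) (y - AffineAveraging.unitVec ν) ν μ -
      lcurl AffineAveraging.unitVec (fun w κ => A κ w) y ν μ) := by
  have anti : ∀ (w : Fin (d + 1) → ℤ) (κ l : Fin (d + 1)), lcurl AffineAveraging.unitVec (fun w μ => A μ w) w κ l =
      -lcurl AffineAveraging.unitVec (fun w μ => A μ w) w l κ := by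
    intro w κ l; unfold lcurl; ring
  unfold curvAdj
  simp only [curv_eq_lcurl]
  rw [Finset.mul_sum, ← Finset.sum_add_distrib]
  refine Finset.sum_congr rfl fun ν _ => ?_
  rw [anti y μ ν, anti (y - AffineAveraging.unitVec ν) μ ν]; ring

/-- **THE CONTACT FUNCTIONAL IS HALF THE `d*d` MATRIX ENTRY**: `(d*d δ_{(a,X)})_α(u) = 2 · Lc unitVec α u (X, a)`. [folklore] -/
theorem curvAdj_curv_delta1_eq_two_mul_Lc (a α : Fin (d + 1)) (X u : Fin (d + 1) → ℤ) :
    curvAdj (curv (delta1 a X)) α u = 2 * Lc unitVec α u (X, a) := by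
  rw [curvAdj_curv_eq_two_mul]
  have h₁ : (fun (w : Fin (d + 1) → ℤ) (κ : Fin (d + 1)) => delta1 a X κ w) = bondLetter X a (1 : ℝ) := by
    funext w κ; unfold bondLetter; rw [delta1_apply]; exact if_congr and_comm rfl rfl
  have h₂ : (AffineAveraging.unitVec : Fin (d + 1) → Fin (d + 1) → ℤ) = unitVec := funext unitVec_eq
  rw [h₁, h₂]
  rfl

end Tables

/-! ## §4 The contact table and the headline -/

section Headline

/-- **THE WILSON CONTACT TABLE** `wilsonCt d α κ′ u` (field–field block only): `[κ′ = α] · (d*d δ_{(b,z)})_a(x) · ([x = u ∧ a = κ′] − [z = u ∧ b = κ′])`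
— verbatim the right-hand side of an2's `DiagonalContact.conjV_bhKAt_ctGen_inl_inl` with the window-free `d*d` entry; zero on every
block touching a multiplier leg.  A definition asserting nothing. [folklore] -/
def wilsonCt (d : ℕ) (α κ' : Fin (d + 1)) (u : Fin (d + 1) → ℤ) : MKer (d + 1) (Fib d) :=
  fun x z a b =>
    match a, b with
    | Sum.inl a, Sum.inl b => (if κ' = α then 1 else 0) * curvAdj (curv (delta1 b z)) a x *
        ((if x = u ∧ a = κ' then 1 else 0) - (if z = u ∧ b = κ' then 1 else 0))
    | Sum.inl _, Sum.inr _ => 0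
    | Sum.inr _, Sum.inl _ => 0
    | Sum.inr _, Sum.inr _ => 0

/-- the field–field entries of the contact table. [folklore] -/
theorem wilsonCt_inl_inl (α κ' : Fin (d + 1)) (u x z : Fin (d + 1) → ℤ) (a b : Fin (d + 1)) :
    wilsonCt d α κ' u x z (Sum.inl a) (Sum.inl b) = (if κ' = α then 1 else 0) * curvAdj (curv (delta1 b z)) a x *
      ((if x = u ∧ a = κ' then 1 else 0) - (if z = u ∧ b = κ' then 1 else 0)) := rfl

/-- **IDENTIFICATION WITH an2's PRODUCT-CHART CONTACT**: on the field–field block `wilsonCt` IS `conjV (bhKAt) (diagK ctGen)`, for every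
window parameter `L`. [folklore] -/
theorem wilsonCt_inl_inl_eq_conjV (α : Fin (d + 1)) (L : ℕ) (κ' : Fin (d + 1)) (u x z : Fin (d + 1) → ℤ) (a b : Fin (d + 1)) :
    wilsonCt d α κ' u x z (Sum.inl a) (Sum.inl b) =
      conjV (bhKAt d (ctr (d + 1) L) L) (diagK (ctGen d α L κ' u)) x z (Sum.inl a) (Sum.inl b) := by
  rw [conjV_bhKAt_ctGen_inl_inl, bhK_inl_inl_eq]; rfl

/-- **THE FIELD–FIELD ENTRY OF THE LAW**. [folklore] -/
theorem wilsonA_bref_inl_inl (α κ' : Fin (d + 1)) (u x z : Fin (d + 1) → ℤ) (a b : Fin (d + 1)) :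
    wilsonA d κ' (bref α κ' u) x z (Sum.inl a) (Sum.inl b) =
      reflSign α κ' * (reflSign α a * reflSign α b * (wilsonA d κ' u (bref α a x) (bref α b z) (Sum.inl a) (Sum.inl b) +
        -(1 / 2) * wilsonCt d α κ' u (bref α a x) (bref α b z) (Sum.inl a) (Sum.inl b))) := by
  rw [wilsonA_inl_inl, wilsonA_inl_inl, S₀A_bref, wilsonCt_inl_inl]
  by_cases hκ : κ' = α
  · subst hκ
    have l₁ : Lc unitVec κ' u (bref κ' a x, a) = (1 / 2) * curvAdj (curv (delta1 a (bref κ' a x))) κ' u := by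
      rw [curvAdj_curv_delta1_eq_two_mul_Lc]; ring
    have l₂ : Lc unitVec κ' u (bref κ' b z, b) = (1 / 2) * curvAdj (curv (delta1 b (bref κ' b z))) κ' u := by
      rw [curvAdj_curv_delta1_eq_two_mul_Lc]; ring
    have i₁ : ((u, κ') = (bref κ' b z, b)) ↔ (bref κ' b z = u ∧ b = κ') := by
      simp only [Prod.mk.injEq]; exact ⟨fun h => ⟨h.1.symm, h.2.symm⟩, fun h => ⟨h.1.symm, h.2.symm⟩⟩
    have i₂ : ((u, κ') = (bref κ' a x, a)) ↔ (bref κ' a x = u ∧ a = κ') := by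
      simp only [Prod.mk.injEq]; exact ⟨fun h => ⟨h.1.symm, h.2.symm⟩, fun h => ⟨h.1.symm, h.2.symm⟩⟩
    rw [l₁, l₂]
    simp only [if_true, i₁, i₂]
    by_cases h₁ : bref κ' b z = u ∧ b = κ'
    · by_cases h₂ : bref κ' a x = u ∧ a = κ'
      · rw [if_pos h₁, if_pos h₂]
        obtain ⟨hZ, rfl⟩ := h₁
        obtain ⟨hX, rfl⟩ := h₂
        rw [hX, hZ]; ring
      · rw [if_pos h₁, if_neg h₂]
        obtain ⟨hZ, rfl⟩ := h₁
        rw [hZ, curvAdj_curv_delta1_symm a b (bref b a x) u]; ring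
    · by_cases h₂ : bref κ' a x = u ∧ a = κ'
      · rw [if_neg h₁, if_pos h₂]
        obtain ⟨hX, rfl⟩ := h₂
        rw [hX]; ring
      · rw [if_neg h₁, if_neg h₂]; ring
  · rw [if_neg (Ne.symm hκ), if_neg hκ]; ring

/-- **HEADLINE — THE REFLECTION LAW WITH CONTACT OF THE WILSON TABLE** (an2's (Sr-conj) shape, X-an2-45 §3 (ii) ∕ (R45-4)):
`wilsonA d κ′ (bref α κ′ u) = reflSign α κ′ • refK (Φ N α) (wilsonA d κ′ u + (−½) • wilsonCt d α κ′ u)` for every blocking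
parameter `N` (the field legs of `Φ N α` do not depend on `N`).  The constant `−½` is decided by the kernel. [folklore] -/
theorem wilsonA_bref (N : ℕ) (α κ' : Fin (d + 1)) (u : Fin (d + 1) → ℤ) :
    wilsonA d κ' (bref α κ' u) = reflSign α κ' • refK (Φ N α) (wilsonA d κ' u + (-(1 / 2) : ℝ) • wilsonCt d α κ' u) := by
  funext x z a b
  simp only [Pi.smul_apply, Pi.add_apply, smul_eq_mul, refK_apply]
  rcases a with a | a <;> rcases b with b | b
  · rw [Φ_s_inl, Φ_s_inl, Φ_r_inl, Φ_r_inl, wilsonA_bref_inl_inl]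
  · rw [wilsonA_inl_inr, wilsonA_inl_inr]; simp [wilsonCt]
  · rw [wilsonA_inr_inl, wilsonA_inr_inl]; simp [wilsonCt]
  · rw [wilsonA_inr_inr, wilsonA_inr_inr]; simp [wilsonCt]

/-- **THE SAME LAW WITH an2's CONTACT KERNEL NAMED**: on the field–field block, for every `L`,
`wilsonA d κ′ (bref α κ′ u) x z (inl a) (inl b) = ε_κ′ ε_a ε_b · (wilsonA d κ′ u X Z (inl a) (inl b) − ½ · conjV (bhKAt d (ctr (d+1) L) L) (diagK (ctGen d α L κ′ u)) X Z (inl a) (inl b))`,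
`X = bref α a x`, `Z = bref α b z`. [folklore] -/
theorem wilsonA_bref_inl_inl_conjV (L : ℕ) (α κ' : Fin (d + 1)) (u x z : Fin (d + 1) → ℤ) (a b : Fin (d + 1)) :
    wilsonA d κ' (bref α κ' u) x z (Sum.inl a) (Sum.inl b) =
      reflSign α κ' * (reflSign α a * reflSign α b * (wilsonA d κ' u (bref α a x) (bref α b z) (Sum.inl a) (Sum.inl b) +
        -(1 / 2) * conjV (bhKAt d (ctr (d + 1) L) L) (diagK (ctGen d α L κ' u)) (bref α a x) (bref α b z)
          (Sum.inl a) (Sum.inl b))) := by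
  rw [wilsonA_bref_inl_inl, wilsonCt_inl_inl_eq_conjV α L]

end Headline

end Summit.QuantumFields.BalabanUV.Beta.WilsonReflectionContact
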